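import Mathlib.Algebra.BigOperators.Fin
import Mathlib.Algebra.MvPolynomial.CommRing
import Summits.CriticalPhenomena.PercolationContinuityZ3.Theorems.PercNearOneGluingNoHeavyLowerTailSahiCTCReduction
import HarnessLib

/-!
# `NoHeavyLowerTail` (crux stmt-CriticalPhenomena-4575), P3 lane: VERIFIED COEFFICIENT TABLES for the c = 2 certificate polynomial `Ñ₂` on
# five points — a computable evaluator `n2Tab K_X K_Z` whose entries are, provably, the coefficients of `N2gen K_X K_Z`

Support file (seat `prim-l12-p3`, gen 20; `--supports stmt-CriticalPhenomena-4575`; `--computational`: the finitely many arithmetic facts about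
base-5 / base-2 codes on `Fin 5` are discharged by `native_decide`, everything about polynomials is proved).  Memo
`run/shared/lean/prim/prim-l12/FROM-prim-l12-p3-g20-*.md`.

Purpose: a kernel check of `Ñ₂(K_X,K_Z) ∈ ℕ[r]` for the pairs of complexes on `Fin 5` (`…SahiCTCN2Five`), hence (with `…SahiCTCN2Monotone`) the
c = 2 coefficientwise threshold certificate on five points and Kahn's Conjecture 5 / Sahi's `C₃` for the majority-of-five first slot.
* Exponent vectors with entries `≤ 4` are `f : Fin 5 → Fin 5`, coded by `codeOf f = Σ f i·5^i < 3125` (`finFunctionFinEquiv`); `fsOf f` is the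
  `Finsupp`.  Sets `S ⊆ Fin 5` are coded by `encS S = Σ_{i∈S} 2^i`.
* A TABLE is an `Array ℤ` read through `getD · 0`; it TABULATES `P` when `t[codeOf f] = coeff (fsOf f) P` for all `f`.
* `mulFam t F` implements `P ↦ GF(F)·P` on tables by the recurrence `coeff_n(GF(F)·P) = Σ_{S∈F, 1_S ≤ n} coeff_{n−1_S} P`
  (`SahiCTCGenFun.coeff_gf_mul`); `rep_mulFam` proves it correct (the digit bookkeeping — "`1_S ≤ n` iff the mask of `S` misses the zero digits of
  the code", "subtracting `1_S` is subtracting `Σ_{i∈S} 5^i`" — is checked once for all `3125 × 32` cases by `native_decide`).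
* `n2Tab K_X K_Z` assembles `Ñ₂` from `…SahiCTCReduction.N2gen`'s definition (`rep_n2Tab`), and `coeff_N2gen_nonneg_of_tabNonneg`: if every
  entry of the table is `≥ 0` then every coefficient of `Ñ₂(K_X,K_Z)` is `≥ 0` (coefficients at exponent vectors with an entry `≥ 5` vanish:
  `Ñ₂` has degree `≤ 4` in each variable, `degreeOf_N2gen_le`).
Nothing is asserted about the crux.
-/

namespace Summit.CriticalPhenomena.PercolationContinuityZ3.Theorems.SahiCTCForms

open Finset MvPolynomial SahiCTCGenFun

namespace N2Five

/-! ### Codes of exponent vectors and of sets -/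

/-- The base-5 code of a small exponent vector. [this work] -/
def codeOf (f : Fin 5 → Fin 5) : ℕ := (finFunctionFinEquiv f : ℕ)

/-- The exponent vector `f` as a `Finsupp`. [this work] -/
noncomputable def fsOf (f : Fin 5 → Fin 5) : Fin 5 →₀ ℕ := Finsupp.equivFunOnFinite.symm fun i => (f i : ℕ)

/-- The bit code of a subset of `Fin 5`. [this work] -/
def encS (S : Finset (Fin 5)) : ℕ := ∑ i ∈ S, 2 ^ (i : ℕ)

/-- Subtract the indicator of `S` from `f` (truncated). [this work] -/
def fsub (f : Fin 5 → Fin 5) (S : Finset (Fin 5)) : Fin 5 → Fin 5 :=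
  fun i => if i ∈ S then ⟨(f i : ℕ) - 1, lt_of_le_of_lt (Nat.sub_le _ _) (f i).isLt⟩ else f i

/-- Bit mask of the zero base-5 digits (among the first five) of `e`. [this work] -/
def zeroDigits (e : ℕ) : ℕ := ∑ i ∈ (univ : Finset (Fin 5)).filter (fun i : Fin 5 => e / 5 ^ (i : ℕ) % 5 = 0), 2 ^ (i : ℕ)

/-- `Σ_{i ∈ mask} 5^i`. [this work] -/
def shiftOf (m : ℕ) : ℕ := ∑ i ∈ (univ : Finset (Fin 5)).filter (fun i : Fin 5 => m.testBit (i : ℕ)), 5 ^ (i : ℕ)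

/-- Table of `zeroDigits` on the `3125` exponent codes. [this work] -/
def zdTab : Array ℕ := Array.ofFn (n := 3125) fun e => zeroDigits e

/-- Table of `shiftOf` on the `32` set codes. [this work] -/
def shTab : Array ℕ := Array.ofFn (n := 32) fun m => shiftOf m

/-- Codes are `< 5^5`. [this work] -/
theorem codeOf_lt (f : Fin 5 → Fin 5) : codeOf f < 3125 := (finFunctionFinEquiv f).isLt

/-- Reading an `ofFn` table inside its range. [folklore] -/
theorem getD_ofFn {β : Type*} {n : ℕ} (g : Fin n → β) (d : β) {i : ℕ} (h : i < n) : (Array.ofFn g).getD i d = g ⟨i, h⟩ := by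
  rw [Array.getD_eq_getD_getElem?, Array.getElem?_ofFn, dif_pos h, Option.getD_some]

/-- `fsOf f i = f i`. [this work] -/
@[simp] theorem fsOf_apply (f : Fin 5 → Fin 5) (i : Fin 5) : fsOf f i = (f i : ℕ) := by
  simp [fsOf]

/-- `1_S ≤ f` iff `f ≥ 1` on `S`. [this work] -/
theorem ind_le_fsOf_iff (S : Finset (Fin 5)) (f : Fin 5 → Fin 5) : ind S ≤ fsOf f ↔ ∀ i ∈ S, 1 ≤ (f i : ℕ) := by
  rw [Finsupp.le_def]
  constructor
  · intro h i hi; have := h i; rw [ind_apply, if_pos hi, fsOf_apply] at this; exact this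
  · intro h i; rw [ind_apply, fsOf_apply]; split_ifs with hi
    · exact h i hi
    · exact Nat.zero_le _

/-- `fsOf (fsub f S) = fsOf f − 1_S` (truncated subtraction on both sides). [this work] -/
theorem fsOf_fsub (f : Fin 5 → Fin 5) (S : Finset (Fin 5)) : fsOf (fsub f S) = fsOf f - ind S := by
  ext i
  rw [Finsupp.tsub_apply, fsOf_apply, fsOf_apply, ind_apply]
  unfold fsub
  by_cases hi : i ∈ S
  · rw [if_pos hi, if_pos hi]
  · rw [if_neg hi, if_neg hi, Nat.sub_zero]

/-- DIGIT FACT 1 (checked on all `3125 × 32` cases): the mask of `S` misses the zero digits of `codeOf f` iff `f ≥ 1` on `S`. [this work] -/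
theorem mask_zd_iff : ∀ f : Fin 5 → Fin 5, ∀ S : Finset (Fin 5),
    (encS S &&& zdTab.getD (codeOf f) 0 = 0) = decide (∀ i ∈ S, 1 ≤ (f i : ℕ)) := by native_decide

/-- DIGIT FACT 2: subtracting `1_S` from `f` is subtracting `Σ_{i∈S} 5^i` from its code (no borrow). [this work] -/
theorem codeOf_fsub : ∀ f : Fin 5 → Fin 5, ∀ S : Finset (Fin 5),
    (∀ i ∈ S, 1 ≤ (f i : ℕ)) → codeOf (fsub f S) = codeOf f - shTab.getD (encS S) 0 := by native_decide

/-- DIGIT FACT 3: `codeOf f = 0` iff `f = 0`. [this work] -/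
theorem codeOf_eq_zero_iff : ∀ f : Fin 5 → Fin 5, codeOf f = 0 ↔ ∀ i, (f i : ℕ) = 0 := by native_decide

/-- Every exponent vector with entries `≤ 4` is an `fsOf`. [this work] -/
theorem exists_fsOf_of_small {n : Fin 5 →₀ ℕ} (hn : ∀ i, n i ≤ 4) : ∃ f : Fin 5 → Fin 5, fsOf f = n :=
  ⟨fun i => ⟨n i, Nat.lt_succ_of_le (hn i)⟩, by ext i; rw [fsOf_apply]⟩

/-! ### Tables and the representation predicate -/

/-! A table `t` TABULATES `P` when `∀ f : Fin 5 → Fin 5, t.getD (codeOf f) 0 = P.coeff (fsOf f)` (all exponent vectors with entries `≤ 4`);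
we spell this predicate out in every statement (no `Prop`-valued definition). -/

/-- The table of the constant `1`. [this work] -/
def oneTab : Array ℤ := Array.ofFn (n := 3125) fun e => if (e : ℕ) = 0 then 1 else 0

/-- Pointwise sum of tables. [this work] -/
def addTab (s t : Array ℤ) : Array ℤ := Array.ofFn (n := 3125) fun e => s.getD e 0 + t.getD e 0

/-- Pointwise difference of tables. [this work] -/
def subTab (s t : Array ℤ) : Array ℤ := Array.ofFn (n := 3125) fun e => s.getD e 0 - t.getD e 0

/-- One term of the product recurrence: `[1_S ≤ e] · t[e − 1_S]` on codes. [this work] -/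
def mulTerm (zdE : ℕ) (t : Array ℤ) (e m : ℕ) : ℤ := if m &&& zdE = 0 then t.getD (e - shTab.getD m 0) 0 else 0

/-- The set codes of a family. [this work] -/
def famCodes (F : Finset (Finset (Fin 5))) : Multiset ℕ := F.val.map encS

/-- `t ↦` the table of `GF(F) · P` (`F` given by its codes). [this work] -/
def mulFam (t : Array ℤ) (Fm : Multiset ℕ) : Array ℤ :=
  Array.ofFn (n := 3125) fun e => (Fm.map (mulTerm (zdTab.getD e 0) t e)).sum

/-- `oneTab` tabulates `1`. [this work] -/
theorem rep_one : (∀ f : Fin 5 → Fin 5, (oneTab).getD (codeOf f) 0 = ((1 : MvPolynomial (Fin 5) ℤ)).coeff (fsOf f)) := by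
  intro f
  rw [oneTab, getD_ofFn _ _ (codeOf_lt f), coeff_one]
  have h0 : codeOf f = 0 ↔ (0 : Fin 5 →₀ ℕ) = fsOf f := by
    rw [codeOf_eq_zero_iff]
    constructor
    · intro h; ext i; rw [fsOf_apply, h i]; rfl
    · intro h i; have := congrArg (fun g => g i) h; simp only [fsOf_apply, Finsupp.coe_zero, Pi.zero_apply] at this; exact this.symm
  by_cases h : codeOf f = 0
  · rw [if_pos h, if_pos (h0.1 h)]
  · rw [if_neg h, if_neg (fun h' => h (h0.2 h'))]

/-- `addTab` tabulates sums. [this work] -/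
theorem rep_add {s t : Array ℤ} {P Q : MvPolynomial (Fin 5) ℤ} (hs : (∀ f : Fin 5 → Fin 5, (s).getD (codeOf f) 0 = (P).coeff (fsOf f)))
    (ht : (∀ f : Fin 5 → Fin 5, (t).getD (codeOf f) 0 = (Q).coeff (fsOf f))) : (∀ f : Fin 5 → Fin 5, (addTab s t).getD (codeOf f) 0 = (P + Q).coeff (fsOf f)) := by
  intro f; rw [addTab, getD_ofFn _ _ (codeOf_lt f), coeff_add, hs f, ht f]

/-- `subTab` tabulates differences. [this work] -/
theorem rep_sub {s t : Array ℤ} {P Q : MvPolynomial (Fin 5) ℤ} (hs : (∀ f : Fin 5 → Fin 5, (s).getD (codeOf f) 0 = (P).coeff (fsOf f)))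
    (ht : (∀ f : Fin 5 → Fin 5, (t).getD (codeOf f) 0 = (Q).coeff (fsOf f))) : (∀ f : Fin 5 → Fin 5, (subTab s t).getD (codeOf f) 0 = (P - Q).coeff (fsOf f)) := by
  intro f; rw [subTab, getD_ofFn _ _ (codeOf_lt f), coeff_sub, hs f, ht f]

/-- **The product recurrence is correct**: `mulFam t F` tabulates `GF(F)·P` when `t` tabulates `P`. [this work] -/
theorem rep_mulFam {t : Array ℤ} {P : MvPolynomial (Fin 5) ℤ} (ht : (∀ f : Fin 5 → Fin 5, (t).getD (codeOf f) 0 = (P).coeff (fsOf f)))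
    (F : Finset (Finset (Fin 5))) : (∀ f : Fin 5 → Fin 5, (mulFam t (famCodes F)).getD (codeOf f) 0 = (gf F * P).coeff (fsOf f)) := by
  intro f
  rw [mulFam, getD_ofFn _ _ (codeOf_lt f), famCodes, Multiset.map_map, coeff_gf_mul, sum_filter]
  change ∑ S ∈ F, mulTerm (zdTab.getD (codeOf f) 0) t (codeOf f) (encS S) = _
  refine sum_congr rfl fun S _ => ?_
  unfold mulTerm
  have h1 := mask_zd_iff f S
  by_cases hc : ∀ i ∈ S, 1 ≤ (f i : ℕ)
  · rw [decide_eq_true hc] at h1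
    rw [if_pos (h1.mpr rfl), if_pos ((ind_le_fsOf_iff S f).2 hc), ← codeOf_fsub f S hc, ht (fsub f S), fsOf_fsub]
  · rw [decide_eq_false hc] at h1
    rw [if_neg (fun h => Bool.false_ne_true (h1.mp h)), if_neg (fun h => hc ((ind_le_fsOf_iff S f).1 h))]

/-! ### Degree bound: coefficients of `Ñ₂` at exponent vectors with an entry `≥ 5` vanish -/

/-- A generating function has degree `≤ 1` in each variable. [this work] -/
theorem degreeOf_gf_le {α : Type*} [DecidableEq α] (F : Finset (Finset α)) (i : α) : degreeOf i (gf F) ≤ 1 := by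
  rw [degreeOf_le_iff]
  intro m hm
  rw [mem_support_iff, coeff_gf] at hm
  obtain ⟨S, hS⟩ : (F.filter fun S => ind S = m).Nonempty := by
    apply nonempty_of_ne_empty; intro h; rw [h, card_empty] at hm; exact hm rfl
  rw [← (mem_filter.1 hS).2, ind_apply]
  split_ifs <;> omega

section deg
variable (KX KZ : Finset (Finset (Fin 5)))

/-- `Ñ₂` has degree `≤ 4` in each variable. [this work] -/
theorem degreeOf_N2gen_le (i : Fin 5) : degreeOf i (N2gen KX KZ) ≤ 4 := by
  have hg : ∀ F : Finset (Finset (Fin 5)), degreeOf i (gf F) ≤ 1 := fun F => degreeOf_gf_le F i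
  have hPi : degreeOf i (PiP : MvPolynomial (Fin 5) ℤ) ≤ 1 := hg _
  have hDd : degreeOf i (Dd : MvPolynomial (Fin 5) ℤ) ≤ 1 := hg _
  have hTh : degreeOf i (Th : MvPolynomial (Fin 5) ℤ) ≤ 1 := hg _
  have he2 : degreeOf i (ee 2 : MvPolynomial (Fin 5) ℤ) ≤ 1 := hg _
  have mul2 : ∀ {p q : MvPolynomial (Fin 5) ℤ} {a b : ℕ}, degreeOf i p ≤ a → degreeOf i q ≤ b → degreeOf i (p * q) ≤ a + b :=
    fun hp hq => (degreeOf_mul_le i _ _).trans (Nat.add_le_add hp hq)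
  have add2 : ∀ {p q : MvPolynomial (Fin 5) ℤ} {a : ℕ}, degreeOf i p ≤ a → degreeOf i q ≤ a → degreeOf i (p + q) ≤ a :=
    fun hp hq => (degreeOf_add_le i _ _).trans (max_le hp hq)
  have sub2 : ∀ {p q : MvPolynomial (Fin 5) ℤ} {a : ℕ}, degreeOf i p ≤ a → degreeOf i q ≤ a → degreeOf i (p - q) ≤ a :=
    fun hp hq => (degreeOf_sub_le i _ _).trans (max_le hp hq)
  unfold N2gen
  refine add2 (sub2 (sub2 ?_ ?_) ?_) ?_
  · exact (mul2 (mul2 he2 (add2 hPi hDd)) (sub2 (mul2 hPi (hg _)) (mul2 (hg _) (hg _)))).trans (by norm_num)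
  · exact (mul2 (mul2 (mul2 hTh hPi) hDd) (hg _)).trans (by norm_num)
  · exact (mul2 (mul2 he2 hDd) (add2 (mul2 (hg _) (hg _)) (mul2 (hg _) (hg _)))).trans (by norm_num)
  · exact (mul2 (mul2 (mul2 he2 hTh) (hg _)) (hg _)).trans (by norm_num)

/-- Coefficients of `Ñ₂` vanish at exponent vectors with an entry `≥ 5`. [this work] -/
theorem coeff_N2gen_eq_zero_of_large {n : Fin 5 →₀ ℕ} (hn : ¬ ∀ i, n i ≤ 4) : (N2gen KX KZ).coeff n = 0 := by
  by_contra h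
  apply hn; intro i
  exact (degreeOf_le_iff.1 (degreeOf_N2gen_le KX KZ i)) n (mem_support_iff.2 h)

end deg

/-! ### The table of `Ñ₂(K_X, K_Z)` -/

/-- Codes of all subsets of `Fin 5`. [this work] -/
def allC : Multiset ℕ := famCodes (univ : Finset (Fin 5)).powerset
/-- Codes of the sets of size `≥ 3`. [this work] -/
def ddC : Multiset ℕ := famCodes (bySize (3 ≤ ·) : Finset (Finset (Fin 5)))
/-- Codes of the sets of size `≤ 2`. [this work] -/
def thC : Multiset ℕ := famCodes (bySize (· ≤ 2) : Finset (Finset (Fin 5)))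
/-- Codes of the sets of size `2`. [this work] -/
def e2C : Multiset ℕ := famCodes (bySize (· = 2) : Finset (Finset (Fin 5)))
/-- Table of `(Π + D)·e₂`. [this work] -/
def tabB : Array ℤ := addTab (mulFam (mulFam oneTab e2C) allC) (mulFam (mulFam oneTab e2C) ddC)
/-- Table of `Π·(Π + D)·e₂`. [this work] -/
def tabA : Array ℤ := mulFam tabB allC
/-- Table of `D·Π·Θ`. [this work] -/
def tabC : Array ℤ := mulFam (mulFam (mulFam oneTab thC) allC) ddC
/-- Table of `D·e₂`. [this work] -/
def tabE : Array ℤ := mulFam (mulFam oneTab e2C) ddC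
/-- Table of `Θ·e₂`. [this work] -/
def tabG : Array ℤ := mulFam (mulFam oneTab e2C) thC

/-- The table of `Ñ₂(K_X,K_Z)` (assembled exactly along the definition of `N2gen`). [this work] -/
def n2Tab (KX KZ : Finset (Finset (Fin 5))) : Array ℤ :=
  addTab (subTab (subTab (subTab
    (mulFam tabA (famCodes (smallCommonFaces KX KZ)))
    (mulFam (mulFam tabB (famCodes (smallFaces KX))) (famCodes (smallFaces KZ))))
    (mulFam tabC (famCodes (commonEdges KX KZ))))
    (addTab (mulFam (mulFam tabE (famCodes (smallFaces KX))) (famCodes (bigFaces KZ)))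
      (mulFam (mulFam tabE (famCodes (bigFaces KX))) (famCodes (smallFaces KZ)))))
    (mulFam (mulFam tabG (famCodes (bigFaces KX))) (famCodes (bigFaces KZ)))

/-- **`n2Tab` tabulates `Ñ₂`.** [this work] -/
theorem rep_n2Tab (KX KZ : Finset (Finset (Fin 5))) : (∀ f : Fin 5 → Fin 5, (n2Tab KX KZ).getD (codeOf f) 0 = (N2gen KX KZ).coeff (fsOf f)) := by
  have hB : (∀ f : Fin 5 → Fin 5, (tabB).getD (codeOf f) 0 = ((PiP * (ee 2 * 1) + Dd * (ee 2 * 1) : MvPolynomial (Fin 5) ℤ)).coeff (fsOf f)) := rep_add (rep_mulFam (rep_mulFam rep_one _) _) (rep_mulFam (rep_mulFam rep_one _) _)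
  have hA : (∀ f : Fin 5 → Fin 5, (tabA).getD (codeOf f) 0 = ((PiP * (PiP * (ee 2 * 1) + Dd * (ee 2 * 1)) : MvPolynomial (Fin 5) ℤ)).coeff (fsOf f)) := rep_mulFam hB _
  have hC : (∀ f : Fin 5 → Fin 5, (tabC).getD (codeOf f) 0 = ((Dd * (PiP * (Th * 1)) : MvPolynomial (Fin 5) ℤ)).coeff (fsOf f)) := rep_mulFam (rep_mulFam (rep_mulFam rep_one _) _) _
  have hE : (∀ f : Fin 5 → Fin 5, (tabE).getD (codeOf f) 0 = ((Dd * (ee 2 * 1) : MvPolynomial (Fin 5) ℤ)).coeff (fsOf f)) := rep_mulFam (rep_mulFam rep_one _) _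
  have hG : (∀ f : Fin 5 → Fin 5, (tabG).getD (codeOf f) 0 = ((Th * (ee 2 * 1) : MvPolynomial (Fin 5) ℤ)).coeff (fsOf f)) := rep_mulFam (rep_mulFam rep_one _) _
  have key := rep_add (rep_sub (rep_sub (rep_sub (rep_mulFam hA (smallCommonFaces KX KZ))
    (rep_mulFam (rep_mulFam hB (smallFaces KX)) (smallFaces KZ))) (rep_mulFam hC (commonEdges KX KZ)))
    (rep_add (rep_mulFam (rep_mulFam hE (smallFaces KX)) (bigFaces KZ)) (rep_mulFam (rep_mulFam hE (bigFaces KX)) (smallFaces KZ))))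
    (rep_mulFam (rep_mulFam hG (bigFaces KX)) (bigFaces KZ))
  intro f
  unfold n2Tab
  rw [key f]
  congr 1
  unfold N2gen
  ring

/-- All entries of a table are `≥ 0`. [this work] -/
def tabNonneg (t : Array ℤ) : Bool := (List.range 3125).all fun e => decide (0 ≤ t.getD e 0)

/-- **Soundness of the table check**: if every entry of `n2Tab K_X K_Z` is `≥ 0` then `Ñ₂(K_X,K_Z) ∈ ℕ[r]`. [this work] -/
theorem coeff_N2gen_nonneg_of_tabNonneg {KX KZ : Finset (Finset (Fin 5))} (h : tabNonneg (n2Tab KX KZ) = true) (n : Fin 5 →₀ ℕ) :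
    0 ≤ (N2gen KX KZ).coeff n := by
  by_cases hn : ∀ i, n i ≤ 4
  · obtain ⟨f, rfl⟩ := exists_fsOf_of_small hn
    rw [← rep_n2Tab KX KZ f]
    rw [tabNonneg, List.all_eq_true] at h
    have := h (codeOf f) (List.mem_range.2 (codeOf_lt f))
    exact of_decide_eq_true this
  · rw [coeff_N2gen_eq_zero_of_large KX KZ hn]

end N2Five

end Summit.CriticalPhenomena.PercolationContinuityZ3.Theorems.SahiCTCForms
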